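import Literature.InformationTheory.QuantumCodes.BivariateBicycleCode756
import Literature.InformationTheory.QuantumCodes.TwoBlockConnectedComponents
import Literature.InformationTheory.QuantumCodes.TwoBlockToricLayout
import Literature.InformationTheory.QuantumCodes.TwoBlockWheelComponents
import HarnessLib
import HarnessLib.Audit.Tags

/-!
# `[[756,16,≤34]]` (the seventh Table-3 code) has a CONNECTED Tanner graph, a TORIC LAYOUT `(μ, λ) = (18, 21)`,
# and two WHEEL-GRAPH layers — Bravyi et al. 2024 §5 Lemmas 3 / 4 / 2 (minus planarity) instantiated on `BB.bb756`

Companion of `Census/BB/Layout.lean` and `Census/BB/WheelLayers.lean` (which cover `bb72 … bb288`, `bb360`) for the code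
`BB.bb756` = `QC(x³+y¹⁰+y¹⁷, y⁵+x³+x¹⁹)` on `ℤ₂₁ × ℤ₁₈` typed in `BivariateBicycleCode756.lean` (page grade of its
`(ℓ, m, A, B)` stated there; W1/acq-11573 open). HONEST FRAMING (qec cell): column word PROVED — kernel theorems on the
tree's data object; they assert GRAPH-THEORETIC properties of the printed Tanner graph ("although all codes in Table are
connected", arXiv:2308.07915 chunk p0011 L7; "All codes in Table have a toric layout with `μ = m` and `λ = ℓ`", p0011 L39;
Lemma 2's two layers of wheel graphs, p0010 L49–95) and say NOTHING about the distance (the CLAIM `BB756_16_le34_claim` of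
`Census/BB/ClaimsUB.lean`) nor about planarity/thickness (no Mathlib notion; not asserted).

* `bb756_tannerGraph_connected` — Lemma 3 (`BB.Code.tannerGraph_connected_of_unit_mem`): `x = 17·(x³x⁻¹⁹)`,
  `y = 5·(y¹⁰y⁻¹⁷)` lie in the exponent-difference subgroup;
* `bb756_hasToricLayoutWith : HasToricLayoutWith 18 21 …` — Lemma 4 (`BB.Code.hasToricLayoutWith_of_exponents`) with
  `A₂A₃ᵀ = y¹⁰y⁻¹⁷ = y¹¹` (order `m = 18`) and `B₂B₃ᵀ = x³x⁻¹⁹ = x⁵` (order `ℓ = 21`), which generate `ℤ₂₁ × ℤ₁₈`, orders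
  multiplying to `ℓm = 378`; and `bb756_hasToricLayout`;
* `bb756_wheel_layers` — Lemma 2 minus planarity (`BB.Code.exists_wheel_layers`): the Tanner graph is the edge-disjoint
  union of two layers whose components are wheel graphs `prismGraph 36` (`A₃A₂ᵀ = y⁷`, order `18`) and `prismGraph 252`
  (`B₂B₁ᵀ = x³y⁻⁵`, order `lcm(7, 18) = 126`).

The small arithmetic facts are `decide`d on the literal data. No `native_decide`; axioms standard.
-/

namespace Summit.Ventures.QEC.BB

open SimpleGraph
open Literature.InformationTheory.QuantumCodes
open Literature.InformationTheory.QuantumCodes.BB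

/-! ### Orders of the layout generators in `ℤ₂₁ × ℤ₁₈` (decided) -/

/-- `ord((0,10) − (0,17)) = 18` in `ℤ₂₁ × ℤ₁₈` (`A₂A₃ᵀ = y¹⁰y⁻¹⁷ = y¹¹`, order `m = 18`).
[cite: BravyiEtAl2024, §5 after Lemma 4 "toric layout with μ = m" (arXiv:2308.07915 chunk p0011 L39)] -/
theorem addOrderOf_y11_21_18 : addOrderOf (((0 : Fin 21), (10 : Fin 18)) - (0, 17)) = 18 :=
  (addOrderOf_eq_iff (by norm_num)).mpr (by decide)

/-- `ord((3,0) − (19,0)) = 21` in `ℤ₂₁ × ℤ₁₈` (`B₂B₃ᵀ = x³x⁻¹⁹ = x⁵`, order `ℓ = 21`).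
[cite: BravyiEtAl2024, §5 after Lemma 4 "λ = ℓ" (arXiv:2308.07915 chunk p0011 L39)] -/
theorem addOrderOf_x5_21_18 : addOrderOf (((3 : Fin 21), (0 : Fin 18)) - (19, 0)) = 21 :=
  (addOrderOf_eq_iff (by norm_num)).mpr (by decide)

/-! ### `[[756,16,≤34]]` = `QC(x³+y¹⁰+y¹⁷, y⁵+x³+x¹⁹)` on `ℤ₂₁ × ℤ₁₈` -/

/-- The exponent differences `(0,10) − (0,17)` of `A` and `(3,0) − (19,0)` of `B` generate `ℤ₂₁ × ℤ₁₈`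
(`17·x⁵ = x`, `5·y¹¹ = y`). [cite: BravyiEtAl2024, Lemma 4 (i) (arXiv:2308.07915 chunk p0011 L29, L39)] -/
theorem bb756_closure_eq_top :
    AddSubgroup.closure ({((0 : Fin 21), (10 : Fin 18)) - (0, 17), ((3 : Fin 21), (0 : Fin 18)) - (19, 0)} :
      Set (Mono 21 18)) = ⊤ := by
  apply Code.addSubgroup_eq_top_of_unit_mem
  · have h := AddSubgroup.subset_closure (k := ({((0 : Fin 21), (10 : Fin 18)) - (0, 17),
      ((3 : Fin 21), (0 : Fin 18)) - (19, 0)} : Set (Mono 21 18))) (Set.mem_insert_of_mem _ rfl)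
    have e : (17 : ℕ) • (((3 : Fin 21), (0 : Fin 18)) - (19, 0)) = (1, 0) := by decide
    have h' := AddSubgroup.nsmul_mem _ h 17
    rw [e] at h'
    exact h'
  · have h := AddSubgroup.subset_closure (k := ({((0 : Fin 21), (10 : Fin 18)) - (0, 17),
      ((3 : Fin 21), (0 : Fin 18)) - (19, 0)} : Set (Mono 21 18))) (Set.mem_insert _ _)
    have e : (5 : ℕ) • (((0 : Fin 21), (10 : Fin 18)) - (0, 17)) = (0, 1) := by decide
    have h' := AddSubgroup.nsmul_mem _ h 5
    rw [e] at h'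
    exact h'

/-- **`[[756,16,≤34]]` has a connected Tanner graph.** PROVED.
[cite: BravyiEtAl2024, §5 "although all codes in Table are connected" + Lemma 3 (arXiv:2308.07915 chunk p0011 L7–10)] -/
theorem bb756_tannerGraph_connected : bb756.css.tannerGraph.Connected := by
  refine bb756.tannerGraph_connected_of_unit_mem (fun h => absurd (congrFun h (3, 0)) (by decide))
    (fun h => absurd (congrFun h (0, 5)) (by decide)) ?_ ?_
  · have e : ((1 : Fin 21), (0 : Fin 18)) = (17 : ℕ) • (((3 : Fin 21), (0 : Fin 18)) - (19, 0)) := by decide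
    rw [e]
    exact AddSubgroup.nsmul_mem _ (bb756.sub_mem_expDiffSubgroup_B (by decide) (by decide)) 17
  · have e : ((0 : Fin 21), (1 : Fin 18)) = (5 : ℕ) • (((0 : Fin 21), (10 : Fin 18)) - (0, 17)) := by decide
    rw [e]
    exact AddSubgroup.nsmul_mem _ (bb756.sub_mem_expDiffSubgroup_A (by decide) (by decide)) 5

/-- **`[[756,16,≤34]]` has a toric layout with `(μ, λ) = (m, ℓ) = (18, 21)`** (Lemma 4, `i = g = 2`, `j = h = 3`:
`A₂A₃ᵀ = y¹¹` of order `18`, `B₂B₃ᵀ = x⁵` of order `21`). PROVED.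
[cite: BravyiEtAl2024, §5 "All codes in Table have a toric layout with μ = m and λ = ℓ" (arXiv:2308.07915 chunk p0011 L39)] -/
theorem bb756_hasToricLayoutWith : HasToricLayoutWith 18 21 bb756.css.tannerGraph := by
  have h := bb756.hasToricLayoutWith_of_exponents (g := (0, 10)) (g' := (0, 17)) (h := (3, 0)) (h' := (19, 0))
    (by decide) (by decide) (by decide) (by decide) bb756_closure_eq_top
    (by rw [addOrderOf_y11_21_18, addOrderOf_x5_21_18])
  rwa [addOrderOf_y11_21_18, addOrderOf_x5_21_18] at h

/-- `[[756,16,≤34]]` has a toric layout. PROVED. [cite: BravyiEtAl2024, §5 (arXiv:2308.07915 chunk p0011 L39)] -/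
theorem bb756_hasToricLayout : HasToricLayout bb756.css.tannerGraph :=
  ⟨18, 21, by norm_num, by norm_num, bb756_hasToricLayoutWith⟩

set_option maxRecDepth 100000 in -- `decide` of the order `126`
/-- **`[[756,16,≤34]]`**: Tanner graph = edge-disjoint union of two layers, every component of the `A`-layer a wheel
graph `prismGraph 36` (`A₃A₂ᵀ = y⁷` of order `18`), every component of the `B`-layer a wheel graph `prismGraph 252`
(`B₂B₁ᵀ = x³y⁻⁵` of order `lcm(7, 18) = 126`). PROVED (Lemma 2 minus planarity).
[cite: BravyiEtAl2024, Lemma 2 (arXiv:2308.07915 chunk p0010 L49–95)] -/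
theorem bb756_wheel_layers :
    ∃ ΓA ΓB : SimpleGraph ((Mono 21 18 ⊕ Mono 21 18) ⊕ (Mono 21 18 ⊕ Mono 21 18)),
    bb756.css.tannerGraph = ΓA ⊔ ΓB ∧ Disjoint ΓA ΓB ∧
    (∀ K : ΓA.ConnectedComponent, Nonempty (K.toSimpleGraph ≃g prismGraph 36)) ∧
    (∀ K : ΓB.ConnectedComponent, Nonempty (K.toSimpleGraph ≃g prismGraph 252)) := by
  have h := bb756.exists_wheel_layers (g₁ := (3, 0)) (g₂ := (0, 10)) (g₃ := (0, 17)) (h₁ := (0, 5))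
    (h₂ := (3, 0)) (h₃ := (19, 0)) (by decide) (by decide) (by decide) (by decide) (by decide) (by decide)
    (fun g => three_monomials_apply_ne_zero_iff 3 0 0 10 0 17 (by decide) (by decide)
      (by decide) g)
    (fun g => three_monomials_apply_ne_zero_iff 0 5 3 0 19 0 (by decide) (by decide)
      (by decide) g)
  have e1 : addOrderOf (((0 : Fin 21), (17 : Fin 18)) - (0, 10)) = 18 :=
    (addOrderOf_eq_iff (by norm_num)).mpr (by decide)
  have e2 : addOrderOf (((3 : Fin 21), (0 : Fin 18)) - (0, 5)) = 126 :=
    (addOrderOf_eq_iff (by norm_num)).mpr (by decide)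
  rw [e1, e2] at h
  exact h

end Summit.Ventures.QEC.BB
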